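import Summits.HubbardSuperconductivity.HubbardSuperconductivity.Theses.LevyLogBootstrap
import Literature.Analysis.Matrix.SchoenbergKernelsProofs
import HarnessLib

/-!
# Crux `Block2InfDivXXZ` (stmt-HubbardSuperconductivity-15048; route `LevyLogBootstrap`, rank 2) —
# BIRTH SKELETON `Lines/birth.lean` (BC3)

THE CRUX (fixed; `Theses/LevyLogBootstrap.lean`, decl `Block2InfDivXXZ`, not restated here): for every
even `M ≥ 4`, every `Δ ∈ [-1, 0]` and every normalised `S^z_tot = 0` sector ground state `ψ` of
`H_M(Δ) = xxzHamiltonian 1 (torusGraph 2 M) (-1) Δ`, every fractional Hadamard power `t ↦ t^s`,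
`s ∈ (0, 1]`, of the (fine-indexed) 2×2-BLOCK transverse kernel
`K₂(x, y) = Σ_{x' ∈ block x, y' ∈ block y} Re⟨ψ, S⁺_{x'} S⁻_{y'} ψ⟩` is positive semidefinite —
infinite divisibility of `K₂`.

THE LINE ("take logarithms" = the route's own thesis, made a kernel-checked seam). By SCHOENBERG'S
THEOREM (Berg–Christensen–Ressel Ch. 3 Thm. 2.2; PROVED in the tree:
`Literature.Analysis.Matrix.Schoenberg1938_negDef_iff_exp_posDef_holds`) an entrywise-positive kernel
is infinitely divisible iff `φ := -log K₂` is a NEGATIVE DEFINITE (negative-type / conditionally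
negative semidefinite) kernel, i.e. `Σ c_x c_y log K₂(x,y) ≥ 0` whenever `Σ c_x = 0`. The crux is
therefore cut at its two natural joints:

1. `stub_transverseKernelPos` — PERRON–FROBENIUS POSITIVITY (theorem-grade, L): every normalised
   `S^z_tot = 0` sector ground state has a strictly positive raw transverse kernel
   `Re⟨ψ, S⁺_{x'} S⁻_{y'} ψ⟩ > 0` for all sites `x', y'` (so `log K₂` and the real powers are genuine).
   Why true: `J = -1 < 0` makes `H_M(Δ)` stoquastic in the Ising basis for every real `Δ`, the
   half-filled sector of the torus `M ≥ 4` is connected under nearest-neighbour hops, so the sector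
   ground state is unique and (up to a phase) entrywise positive (Marshall 1955 / Perron–Frobenius;
   uniqueness + a nonnegative Perron vector is LANDED as `PolyaSchurPairBoson.SectorPerronXXZ`,
   `Theorems.PolyaSchurPairBoson.sectorPerronXXZ_proof`); `S⁺_{x'} S⁻_{y'}` has `0/1` entries and a
   witness configuration (`y'` up, `x'` down, or `x' = y'` up) exists in the sector. What remains is
   strict positivity of the Perron vector (irreducibility) and the phase bookkeeping.
2. `stub_blockLogNegType` — THE BET, K1 in Lévy–Khintchine form (crux-sized, open): for every such
   `ψ`, `(x, y) ↦ -log K₂(x, y)` is a negative definite kernel (`Literature.Analysis.Matrix.IsNegDefKernel`,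
   BCR Def. 3.1.1). TRANSFER, why easier: one closed convex-cone condition, LINEAR in `log K₂`, replaces
   a one-parameter family of nonlinear PSD conditions; by block-translation invariance of `K₂` (unique GS)
   and Bochner on the finite group `(ℤ/(M/2))²` it is EQUIVALENT to finitely many sign conditions
   `ν_k = -φ̂(k) ≥ 0`, `k ≠ 0` — the Lévy coefficients that the route's K2 `LevyTransport` consumes
   (|ν| budget, Goldstone wing, UV mass) and that the route's kill criterion tests by exact
   diagonalisation ("one NEGATIVE Lévy coefficient refutes"). Spin-wave heuristic: in the harmonic
   (Gaussian phase-field) approximation `K₂ ∝ exp(-½ Var(θ_X - θ_Y))` is `exp(-variogram)`, hence of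
   this form exactly; the 2×2 block form factor `(1+e^{ik₁})(1+e^{ik₂})` kills the `(π,π)` / `(π,0)`
   ringing that breaks the RAW kernel on the AF side (card ED: 57/57 block kernels ID on 4×4, 6×4).
   Why it might fail: no positivity principle for the LOG of a ground-state correlation is known beyond
   single axes (RP ⇒ log-convexity along an axis only); a harmonic not annihilated by 2×2 blocks
   (e.g. `(π/2, π/2)` near `Δ → -1`) could appear beyond 24 sites.

COMPOSITION `Block2InfDivXXZ_of : Block2InfDivXXZ` (A12: concludes the crux BY NAME, no hypotheses,
cites the two declared stubs by name; no `sorry` outside the stubs). Seam (sorry-free, this file):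
block positivity from stub 1 (`Finset.single_le_sum`, the pair `(x, y)` itself lies in its blocks);
Schoenberg ⇒ (`Schoenberg1938_negDef_iff_exp_posDef_holds`, ~350 landed lines: BCR Lemma 3.2.1 +
Schur product theorem `Matrix.PosSemidef.hadamard` + exponential series) turns stub 2 into positive
definiteness of the kernel `exp(-s·φ) = K₂^{∘s}` (`Real.rpow_def_of_pos`); kernel → matrix on the
finite index type (`IsPosDefKernel.posSemidef_matrix` along `Fintype.equivFin`,
`Matrix.posSemidef_submatrix_equiv`). The seam delivers ALL `s > 0`, in particular `s ∈ (0, 1]`.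

DISPROOF USED: no `Cruxes/Block2InfDivXXZ/Disproof.lean` exists (2026-08-17, `ledger crux ls`: no
workfiles before this one); `ledger negatives --problem HubbardSuperconductivity` touches neither stub.
Stub 1 is a theorem of Perron–Frobenius type (cannot be an instance of a Negative lemma); stub 2 is the
crux's own content in logarithmic form — any future `Block2InfDivXXZ_false_without_<H>` applies to it
verbatim (same quantifier prefix: ground state, half filling, even `M ≥ 4`, `Δ ∈ [-1,0]` all kept).

Sources: I. J. Schoenberg, Trans. AMS 44 (1938) 522; C. Berg, J. P. R. Christensen, P. Ressel,
*Harmonic Analysis on Semigroups* (1984) Ch. 3 Thm. 2.2, Prop. 2.7, Ch. 4 (Lévy–Khintchine on abelian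
semigroups); R. Bhatia, *Infinitely divisible matrices*, Amer. Math. Monthly 113 (2006) 221;
R. A. Horn, *The theory of infinitely divisible matrices and kernels*, Trans. AMS 136 (1969) 269;
W. Marshall, Proc. R. Soc. A 232 (1955) 48; T. Kennedy, E. H. Lieb, B. S. Shastry, PRL 61 (1988) 2582;
card `levy-mass-log-bootstrap` (K1, block form). No definition is introduced; all statements are over
existing declarations (`IsNegDefKernel` is `Literature/Analysis/Matrix/SchoenbergKernels.lean`).
-/

noncomputable section

-- `dupNamespace`: the summit and the problem are both named `HubbardSuperconductivity` (layout D-0022)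
set_option linter.dupNamespace false

namespace Summit.HubbardSuperconductivity.HubbardSuperconductivity.Cruxes.Block2InfDivXXZ.Birth

open Matrix Finset
open Literature.Probability.LatticeModels Literature.MathematicalPhysics.QuantumLattice
open Literature.Analysis.Matrix
open scoped ComplexOrder Matrix BigOperators

/-! ## The two stubs -/

/-- **STUB 1 `stub_transverseKernelPos` — PERRON–FROBENIUS POSITIVITY OF THE TRANSVERSE KERNEL**
(theorem-grade). For every even `M ≥ 4`, every `Δ ∈ [-1, 0]` and every normalised `S^z_tot = 0`
sector ground state `ψ` of `H_M(Δ) = xxzHamiltonian 1 (torusGraph 2 M) (-1) Δ`, the raw transverse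
kernel is entrywise strictly positive: `0 < Re⟨ψ, S⁺_{x'} S⁻_{y'} ψ⟩` for all sites `x', y'`.
Marshall (1955) / Perron–Frobenius in the half-filled sector: `H_M(Δ)` has non-positive off-diagonal
entries in the Ising basis (`J = -1`), the sector is connected under n.n. hops on the torus, so the
sector ground state is unique (LANDED: `PolyaSchurPairBoson.SectorPerronXXZ`,
`Theorems.PolyaSchurPairBoson.sectorPerronXXZ_proof`, nonnegative Perron vector) and — what remains —
strictly positive up to a phase; `S⁺_{x'} S⁻_{y'}` has `0/1` entries and a witness configuration
exists (`M² ≥ 16` sites, `M²/2` up spins). Tasaki (2020) §2.4–2.5; Kennedy–Lieb–Shastry (1988). -/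
theorem stub_transverseKernelPos :
    ∀ (M : ℕ) [NeZero M], Even M → 4 ≤ M → ∀ Δ ∈ Set.Icc (-1:ℝ) 0,
      ∀ (ψ : TensorIndex (TorusSite 2 M) 2 → ℂ),
        ψ ∈ spinZSector (Λ := TorusSite 2 M) 1 0 → star ψ ⬝ᵥ ψ = 1 →
        Matrix.mulVec (xxzHamiltonian 1 (torusGraph 2 M) (-1) Δ) ψ =
          ((lowestEnergyInSector 1 (xxzHamiltonian 1 (torusGraph 2 M) (-1) Δ) 0 : ℝ) : ℂ) • ψ →
        ∀ x' y' : TorusSite 2 M,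
          0 < (star ψ ⬝ᵥ Matrix.mulVec
            (onSite x' (spinRaise 1) * onSite y' (spinLower 1)) ψ).re := by
  sorry

/-- **STUB 2 `stub_blockLogNegType` — THE 2×2-BLOCK TRANSVERSE KERNEL IS OF NEGATIVE TYPE IN
LOGARITHM (the bet; K1 of card `levy-mass-log-bootstrap` in Lévy–Khintchine form).** For every even
`M ≥ 4`, every `Δ ∈ [-1, 0]` and every normalised `S^z_tot = 0` sector ground state `ψ` of `H_M(Δ)`,
the kernel `(x, y) ↦ -log K₂(x, y)` on the torus sites — `K₂(x, y) = Σ_{x' ∈ block x, y' ∈ block y}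
Re⟨ψ, S⁺_{x'} S⁻_{y'} ψ⟩`, `block x = (⌊x₀/2⌋, ⌊x₁/2⌋)`, fine-indexed exactly as in the crux — is
NEGATIVE DEFINITE (`IsNegDefKernel`, BCR Def. 3.1.1: symmetric, and `Σ c_j c_k φ(x_j, x_k) ≤ 0` for
every finite family with `Σ c_j = 0`). Equivalently (block-translation invariance + finite Bochner):
all Lévy coefficients `ν_k ≥ 0`, `k ≠ 0`, of `φ = -log K₂` on the coarse torus `(ℤ/(M/2))²`. Not
claimed provable now: with stub 1 and Schoenberg's theorem it is EQUIVALENT to the crux (BCR Prop.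
3.2.7); ED evidence only (card: 57/57 block kernels ID on 4×4 all fillings, 6×4; margins 0.06–0.74).
Schoenberg (1938); Berg–Christensen–Ressel (1984) Ch. 3–4; Bhatia (2006); Horn (1969). -/
theorem stub_blockLogNegType :
    ∀ (M : ℕ) [NeZero M], Even M → 4 ≤ M → ∀ Δ ∈ Set.Icc (-1:ℝ) 0,
      ∀ (ψ : TensorIndex (TorusSite 2 M) 2 → ℂ),
        ψ ∈ spinZSector (Λ := TorusSite 2 M) 1 0 → star ψ ⬝ᵥ ψ = 1 →
        Matrix.mulVec (xxzHamiltonian 1 (torusGraph 2 M) (-1) Δ) ψ =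
          ((lowestEnergyInSector 1 (xxzHamiltonian 1 (torusGraph 2 M) (-1) Δ) 0 : ℝ) : ℂ) • ψ →
        IsNegDefKernel fun x y : TorusSite 2 M =>
          -Real.log (∑ x' : TorusSite 2 M, ∑ y' : TorusSite 2 M,
            if (∀ i : Fin 2, (x' i).val / 2 = (x i).val / 2) ∧
                (∀ i : Fin 2, (y' i).val / 2 = (y i).val / 2) then
              (star ψ ⬝ᵥ Matrix.mulVec
                (onSite x' (spinRaise 1) * onSite y' (spinLower 1)) ψ).re
            else 0) := by
  sorry

/-! ## The seam (sorry-free): Schoenberg's theorem, kernel → matrix -/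

/-- Kernel → matrix on a finite index type: a positive definite kernel (`IsPosDefKernel`, BCR
Def. 3.1.1) on a `Fintype` has a positive semidefinite matrix `(φ x y)_{x,y}` (Mathlib
`Matrix.PosSemidef`), by `IsPosDefKernel.posSemidef_matrix` along `Fintype.equivFin` and
`Matrix.posSemidef_submatrix_equiv`. [cite: BergChristensenRessel1984, Ch. 3 §1.2] -/
theorem posSemidef_of_isPosDefKernel {X : Type} [Fintype X] {φ : X → X → ℝ}
    (h : IsPosDefKernel φ) : (Matrix.of fun x y => φ x y).PosSemidef := by
  have hm := h.posSemidef_matrix (Fintype.equivFin X).symm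
  exact (Matrix.posSemidef_submatrix_equiv (Fintype.equivFin X).symm).mp hm

/-- **Schoenberg ⇒ for Hadamard powers** (BCR Ch. 3 Thm. 2.2 / Prop. 2.7, finite index type): an
entrywise strictly positive kernel `K` whose logarithm is of negative type has every real Hadamard
power `K^{∘s}`, `s > 0`, positive semidefinite — `K^{∘s} = exp(-s·(-log K))` entrywise
(`Real.rpow_def_of_pos`) and `Schoenberg1938_negDef_iff_exp_posDef_holds` (⇒).
[cite: BergChristensenRessel1984, Ch. 3 Thm. 2.2, Prop. 2.7] -/
theorem posSemidef_rpow_of_negType {X : Type} [Fintype X] (K : X → X → ℝ)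
    (hpos : ∀ x y, 0 < K x y) (hneg : IsNegDefKernel fun x y => -Real.log (K x y))
    (s : ℝ) (hs : 0 < s) : (Matrix.of fun x y => K x y ^ s).PosSemidef := by
  have hpd : IsPosDefKernel (fun x y => Real.exp (-(s * -Real.log (K x y)))) :=
    (Schoenberg1938_negDef_iff_exp_posDef_holds X _).mp hneg s hs
  have heq : (fun x y => Real.exp (-(s * -Real.log (K x y)))) = fun x y => K x y ^ s := by
    funext x y
    rw [Real.rpow_def_of_pos (hpos x y)]
    congr 1
    ring
  rw [heq] at hpd
  exact posSemidef_of_isPosDefKernel hpd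

/-! ## The composition: the two stubs imply the crux, by name -/

/-- **`Block2InfDivXXZ_of`** — the composition `stub_transverseKernelPos → stub_blockLogNegType →
LevyLogBootstrap.Block2InfDivXXZ` in the harness skeleton convention (A12: concludes the crux BY
NAME, takes no hypotheses, cites the DECLARED stubs by name; its only `sorryAx` dependence is
through them). Given `M, Δ, ψ, s`: the block kernel `K₂` is entrywise positive (each entry is a sum
of nonnegative terms containing the strictly positive term `(x', y') = (x, y)`, stub 1); its
logarithm is of negative type (stub 2); Schoenberg's theorem (landed) gives positive
semidefiniteness of `K₂^{∘s}` for every `s > 0`. [cite: BergChristensenRessel1984, Ch. 3 Thm. 2.2] -/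
theorem Block2InfDivXXZ_of :
    Summit.HubbardSuperconductivity.HubbardSuperconductivity.Theses.LevyLogBootstrap.Block2InfDivXXZ := by
  intro M _ hEven h4 Δ hΔ ψ hψ hnorm heig s hs _hs1
  -- STUB 1: the raw transverse kernel is strictly positive
  have hK : ∀ x' y' : TorusSite 2 M, 0 < (star ψ ⬝ᵥ Matrix.mulVec
      (onSite x' (spinRaise 1) * onSite y' (spinLower 1)) ψ).re :=
    stub_transverseKernelPos M hEven h4 Δ hΔ ψ hψ hnorm heig
  -- hence so is every entry of the block kernel
  have hpos : ∀ x y : TorusSite 2 M, 0 < ∑ x' : TorusSite 2 M, ∑ y' : TorusSite 2 M,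
      (if (∀ i : Fin 2, (x' i).val / 2 = (x i).val / 2) ∧
          (∀ i : Fin 2, (y' i).val / 2 = (y i).val / 2) then
        (star ψ ⬝ᵥ Matrix.mulVec
          (onSite x' (spinRaise 1) * onSite y' (spinLower 1)) ψ).re
      else 0) := by
    intro x y
    have hterm : ∀ x' y' : TorusSite 2 M, 0 ≤
        (if (∀ i : Fin 2, (x' i).val / 2 = (x i).val / 2) ∧
            (∀ i : Fin 2, (y' i).val / 2 = (y i).val / 2) then
          (star ψ ⬝ᵥ Matrix.mulVec
            (onSite x' (spinRaise 1) * onSite y' (spinLower 1)) ψ).re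
        else 0) := by
      intro x' y'
      split_ifs
      · exact (hK x' y').le
      · exact le_rfl
    have hdiag : 0 < (if (∀ i : Fin 2, (x i).val / 2 = (x i).val / 2) ∧
            (∀ i : Fin 2, (y i).val / 2 = (y i).val / 2) then
          (star ψ ⬝ᵥ Matrix.mulVec
            (onSite x (spinRaise 1) * onSite y (spinLower 1)) ψ).re
        else 0) := by
      rw [if_pos ⟨fun _ => rfl, fun _ => rfl⟩]
      exact hK x y
    refine lt_of_lt_of_le hdiag ?_
    refine le_trans ?_ (Finset.single_le_sum (f := fun x' : TorusSite 2 M => ∑ y' : TorusSite 2 M,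
      (if (∀ i : Fin 2, (x' i).val / 2 = (x i).val / 2) ∧
          (∀ i : Fin 2, (y' i).val / 2 = (y i).val / 2) then
        (star ψ ⬝ᵥ Matrix.mulVec
          (onSite x' (spinRaise 1) * onSite y' (spinLower 1)) ψ).re
      else 0)) (fun x' _ => Finset.sum_nonneg fun y' _ => hterm x' y') (Finset.mem_univ x))
    exact Finset.single_le_sum (f := fun y' : TorusSite 2 M =>
      (if (∀ i : Fin 2, (x i).val / 2 = (x i).val / 2) ∧
          (∀ i : Fin 2, (y' i).val / 2 = (y i).val / 2) then
        (star ψ ⬝ᵥ Matrix.mulVec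
          (onSite x (spinRaise 1) * onSite y' (spinLower 1)) ψ).re
      else 0)) (fun y' _ => hterm x y') (Finset.mem_univ y)
  -- STUB 2 + Schoenberg's theorem (landed): every real Hadamard power is positive semidefinite
  exact posSemidef_rpow_of_negType _ hpos
    (stub_blockLogNegType M hEven h4 Δ hΔ ψ hψ hnorm heig) s hs

end Summit.HubbardSuperconductivity.HubbardSuperconductivity.Cruxes.Block2InfDivXXZ.Birth

end
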